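import Literature.AnabelianGeometry.SemiGraphs.PSCSmoothCurveGenuineRestrict
import Literature.AnabelianGeometry.SemiGraphs.ProSigmaCompletionInjective
import Literature.GroupTheory.CombinatorialGroupTheory.PuncturedSurfaceGroupCuspQuotients
import Literature.GroupTheory.CombinatorialGroupTheory.PuncturedSurfaceGroupFree
import HarnessLib

/-!
# A genus-`≥ 2` Galois level of a genuine smooth curve, below which every covering has genus `≥ 2` ([CombGC] Rmk. 1.1.5)

Mochizuki, *A combinatorial version of the Grothendieck conjecture* [CombGC], Tohoku Math. J. **59**
(2007), Rmk. 1.1.5 p. 8: "even if `G` is not sturdy, there always exists a characteristic open subgroup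
`H ⊆ Π_G` which satisfies the following property: Every `G′` which arises as a `Π_G`-covering `G′ → G`
such that `Π_{G′} ⊆ H ⊆ Π_G` is sturdy. [Indeed, this follows immediately from the well-known structure
of fundamental groups of Riemann surfaces.]" [cite: MochizukiCombGC2007, Rmk 1.1.5 p.8]

PROOF-ONLY file (abc-iut cell, layer L3, [CombGC] non-vacuity programme; seat abc-iut-w5-d195 gen 7,
brick «SC-GENUINE-COVERING-CLOSED», part E1).  The "well-known structure" at a GENUINE smooth-curve
datum (profinite `Π`, one vertex `Π_v = Π`, no nodes, `ι : Γ_{g,r} → Π` a pro-`Σ` completion of a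
hyperbolic punctured surface group, cusp groups conjugates of `closure ι⟨c_j⟩`, `genus(v) = g`),
level by level, via Riemann–Hurwitz (`restrict_smoothCurveGenuine`: the covering `G_U` is of type
`(g_U, r_U)` with `2g_U + r_U + 2[Π:U] = [Π:U](2g + r) + 2`) and RAMIFICATION AT THE CUSPS:

* `natCard_doubleCosetQuotient_mul_relIndex_le_index` — for `U ≤ V ⊴ Π`: `#(U \ Π / K) · [K : K ∩ V]
  ≤ [Π : U]` (the cusps of `G_U` over a cusp with group `K` are `K`-orbits on `U \ Π`, each of size
  `≥ [K : K ∩ V]`);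
* `le_relIndex_cuspGp_of_comap_inf_eq` — if `ι⁻¹(V) ∩ ⟨c_j⟩ = ⟨c_j^n⟩` then `[Π_c : Π_c ∩ V] ≥ n` for
  the cusp group `Π_c = δ closure(ι⟨c_j⟩) δ⁻¹` (the image of `c_j` in `Π/V = Γ/ι⁻¹V` has order `n`);
* `two_le_genus_restrict_of_le` — hence, for the open normal `V` with `ι⁻¹(V) = N`, `N ⊴ Γ_{g,r}` the
  uniform cusp-order-`n` subgroup of `PuncturedSurfaceGroup.exists_normal_inf_cuspInertia_eq` with
  `n ≥ r + 1`, EVERY open `U ≤ V` gives a covering `G_U` all of whose vertices have genus `≥ 2`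
  (`n · r_U ≤ r · [Π:U]` in Riemann–Hurwitz);
* `exists_open_normal_forall_two_le_genus_restrict` — such a `V` exists (`N` has `Σ`-integer index
  `∣ ℓ^{3r}`, `ℓ ∈ Σ`, so `N = ι⁻¹(V)` for an open `V` by the universal property of the completion).

The characteristic `H ⊆ V` and Def. 1.1 (ii)'s rank form of "sturdy" are the sequel
(`PSCSmoothCurveGenuineSturdy.lean`).  0 definitions; plain (pro)finite group theory over tree theorems;
nothing here takes a side on [IUTchIII] Cor. 3.12.
-/

noncomputable section

namespace Literature.AnabelianGeometry.SemiGraphs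

namespace PSCDatum

open scoped Pointwise
open PSCCovering
open Literature.GroupTheory.CombinatorialGroupTheory
open Literature.GroupTheory.CombinatorialGroupTheory.PuncturedSurfaceGroup (c cuspInertia IsHyperbolicType
  exists_normal_inf_cuspInertia_eq)
open Literature.AnabelianGeometry.Anabelioids (IsSigmaInteger)
open SemiGraphOfAnabelioids (IsProSigmaCompletion)
open SemiGraphOfAnabelioids.IsProSigmaCompletion (finiteIndex_comap index_comap_of_isOpen
  normal_of_comap_normal isSigmaInteger_prime_pow not_isOfFinOrder_of_isFreeGroup)

universe u

variable {P : Type u} [Group P]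

/-! ### Counting the cusps of a covering inside a Galois level -/

/-- **`#(U \ Π / K) · [K : K ∩ V] ≤ [Π : U]`** for `U ≤ V`, `V` normal, `[Π : U] < ∞`: the map
`(U y K, k(K ∩ V)) ↦ (y k)⁻¹ U` is injective (two cusps of `G_U` over the same cusp of `G` through which
`≥ [K : K ∩ V]` sheets pass). [cite: MochizukiCombGC2007, Def 1.1(ii) p.6] -/
theorem natCard_doubleCosetQuotient_mul_relIndex_le_index (U V K : Subgroup P) [V.Normal] (hUV : U ≤ V)
    [U.FiniteIndex] :
    Nat.card (DoubleCoset.Quotient (U : Set P) (K : Set P)) * V.relIndex K ≤ U.index := by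
  classical
  haveI : Finite (P ⧸ U) := Subgroup.finite_quotient_of_finiteIndex
  let Ψ : DoubleCoset.Quotient (U : Set P) (K : Set P) × (K ⧸ V.subgroupOf K) → P ⧸ U :=
    fun dq => QuotientGroup.mk ((Quotient.out dq.1 * ((Quotient.out dq.2 : K) : P))⁻¹)
  have hΨ : Function.Injective Ψ := by
    rintro ⟨d, q⟩ ⟨d', q'⟩ h
    have h' := QuotientGroup.eq.mp h
    rw [inv_inv] at h'
    -- `y_d k k'⁻¹ y_{d'}⁻¹ ∈ U`
    set y := Quotient.out d with hy
    set y' := Quotient.out d' with hy'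
    set k : P := ((Quotient.out q : K) : P) with hk
    set k' : P := ((Quotient.out q' : K) : P) with hk'
    have hu : y * k * (y' * k')⁻¹ ∈ U := h'
    -- same double coset
    have hdd : d = d' := by
      rw [← Quotient.out_eq d, ← Quotient.out_eq d']
      change DoubleCoset.mk U K y = DoubleCoset.mk U K y'
      rw [DoubleCoset.eq]
      refine ⟨(y * k * (y' * k')⁻¹)⁻¹, U.inv_mem hu, k * k'⁻¹, K.mul_mem (Quotient.out q).2
        (K.inv_mem (Quotient.out q').2), by group⟩
    subst hdd
    have hkk : k * k'⁻¹ ∈ V := by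
      have h1 : y * (k * k'⁻¹) * y⁻¹ ∈ V := by
        rw [show y * (k * k'⁻¹) * y⁻¹ = y * k * (y * k')⁻¹ by group]
        exact hUV hu
      have h2 := ‹V.Normal›.conj_mem _ h1 y⁻¹
      rwa [show y⁻¹ * (y * (k * k'⁻¹) * y⁻¹) * y⁻¹⁻¹ = k * k'⁻¹ by group] at h2
    have hq : q = q' := by
      rw [← Quotient.out_eq q, ← Quotient.out_eq q']
      refine QuotientGroup.eq.mpr ?_
      rw [Subgroup.mem_subgroupOf, Subgroup.coe_mul, Subgroup.coe_inv]
      have h3 := ‹V.Normal›.conj_mem _ (V.inv_mem hkk) k⁻¹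
      rwa [show k⁻¹ * (k * k'⁻¹)⁻¹ * k⁻¹⁻¹ = k⁻¹ * k' by group] at h3
    rw [hq]
  have hcard := Nat.card_le_card_of_injective Ψ hΨ
  rwa [Nat.card_prod] at hcard

/-! ### The order of a cusp generator modulo a level -/

section Order

variable [TopologicalSpace P] [IsTopologicalGroup P]

/-- In a hyperbolic punctured surface group with a cusp, `c_j^k ∈ ⟨c_j^n⟩` forces `n ∣ k` (`Γ_{g,r}`,
`r ≥ 1`, is free and `c_j ≠ 1` has infinite order). [cite: MochizukiSemiAnbd2006, Ex. 2.10 p.31] -/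
theorem dvd_of_c_pow_mem_zpowers {g r : ℕ} (h : IsHyperbolicType g r) (j : Fin r) {n : ℕ} {k : ℕ}
    (hk : c (g := g) j ^ k ∈ Subgroup.zpowers (c (g := g) j ^ n)) : n ∣ k := by
  obtain ⟨m, hm⟩ := Subgroup.mem_zpowers_iff.mp hk
  obtain ⟨r', rfl⟩ : ∃ r', r = r' + 1 := ⟨r - 1, by have := j.2; omega⟩
  obtain ⟨eF⟩ := PuncturedSurfaceGroup.nonempty_mulEquiv_freeGroup g r'
  haveI : IsFreeGroup (PuncturedSurfaceGroup g (r' + 1)) := IsFreeGroup.ofMulEquiv eF.symm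
  have hinj := injective_zpow_iff_not_isOfFinOrder.mpr
    (not_isOfFinOrder_of_isFreeGroup (PuncturedSurfaceGroup.c_ne_one h j))
  have hm' : (c (g := g) j) ^ ((n : ℤ) * m) = (c (g := g) j) ^ (k : ℤ) := by
    rw [zpow_mul, zpow_natCast, hm, zpow_natCast]
  have hnm : (n : ℤ) * m = k := hinj hm'
  exact Int.natCast_dvd_natCast.mp ⟨m, hnm.symm⟩

variable [CompactSpace P]

/-- **The cusp group is ramified of index `≥ n` over a uniform cusp-order-`n` level**: if `V ⊴ Π` is open
with `ι⁻¹(V) ∩ ⟨c_j⟩ = ⟨c_j^n⟩`, then `[K : K ∩ V] ≥ n` for every subgroup `K` containing a conjugate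
`δ ι(c_j) δ⁻¹` (e.g. the cusp group `δ closure(ι⟨c_j⟩) δ⁻¹`): the image of `δ ι(c_j) δ⁻¹` in `K/(K ∩ V)`
has order divisible by `n`. [cite: MochizukiCombGC2007, Rmk 1.1.5 p.8] -/
theorem le_relIndex_of_comap_inf_cuspInertia_eq {g r : ℕ} (h : IsHyperbolicType g r)
    (ι : PuncturedSurfaceGroup g r →* P) (V : Subgroup P) [hVn : V.Normal] (hVo : IsOpen (V : Set P))
    {n : ℕ} (j : Fin r)
    (hN : V.comap ι ⊓ cuspInertia (g := g) j = Subgroup.zpowers (c (g := g) j ^ n))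
    (K : Subgroup P) (δ : ConjAct P) (hK : δ • ι (c (g := g) j) ∈ K) : n ≤ V.relIndex K := by
  haveI : V.FiniteIndex := by
    haveI : DiscreteTopology (P ⧸ V) := QuotientGroup.discreteTopology hVo
    haveI : Finite (P ⧸ V) := finite_of_compact_of_discrete
    exact Subgroup.finiteIndex_of_finite_quotient
  haveI : (V.subgroupOf K).FiniteIndex := inferInstance
  set x : K ⧸ V.subgroupOf K := QuotientGroup.mk ⟨δ • ι (c (g := g) j), hK⟩ with hx
  -- `x ^ k = 1 ↔ n ∣ k`
  have hpow : ∀ k : ℕ, x ^ k = 1 → n ∣ k := by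
    intro k hk1
    rw [hx, ← QuotientGroup.mk_pow, QuotientGroup.eq_one_iff, Subgroup.mem_subgroupOf,
      Subgroup.coe_pow, Subgroup.coe_mk, ← smul_pow', ← map_pow, ConjAct.smul_def] at hk1
    have hmem : ι (c (g := g) j ^ k) ∈ V := by
      have := hVn.conj_mem _ hk1 (ConjAct.ofConjAct δ)⁻¹
      simpa [mul_assoc] using this
    have hmem' : c (g := g) j ^ k ∈ V.comap ι ⊓ cuspInertia (g := g) j :=
      ⟨hmem, Subgroup.pow_mem _ (Subgroup.mem_zpowers _) k⟩
    rw [hN] at hmem'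
    exact dvd_of_c_pow_mem_zpowers h j hmem'
  have hdvd : n ∣ Nat.card (K ⧸ V.subgroupOf K) :=
    (hpow (orderOf x) (pow_orderOf_eq_one x)).trans (orderOf_dvd_natCard x)
  have hne : Nat.card (K ⧸ V.subgroupOf K) ≠ 0 := Subgroup.FiniteIndex.index_ne_zero
  exact Nat.le_of_dvd (Nat.pos_of_ne_zero hne) hdvd

end Order

/-! ### Genus `≥ 2` below a uniform cusp-order level -/

section Genus

variable [TopologicalSpace P] [IsTopologicalGroup P] [CompactSpace P] [TotallyDisconnectedSpace P]
variable (G : PSCDatum P) [IsEmpty G.graph.N] {g r : ℕ}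

/-- **Every covering below a uniform cusp-order-`n` Galois level, `n ≥ r + 1`, has genus `≥ 2`.**  For a
genuine smooth-curve datum `G` of type `(g, r)` and an open normal `V` with `ι⁻¹(V) ∩ ⟨c_j⟩ = ⟨c_j^n⟩` for
all `j`, `n ≥ r + 1`: for every open `U ≤ V` the covering `G_U`, of type `(g_U, r_U)` with
`2g_U + r_U + 2[Π:U] = [Π:U](2g + r) + 2` (`restrict_smoothCurveGenuine`), has `n · r_U ≤ r · [Π:U]`,
whence `g_U ≥ 2`. [cite: MochizukiCombGC2007, Rmk 1.1.5 p.8] -/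
theorem two_le_genus_restrict_of_le (hV : ∀ v, G.vertGp v = ⊤) (v₀ : G.graph.V) (hv : ∀ w, w = v₀)
    (h : IsHyperbolicType g r) (ι : PuncturedSurfaceGroup g r →* P) (hι : IsProSigmaCompletion G.Sigma ι)
    (e : G.graph.C ≃ Fin r)
    (hC : ∀ c, ∃ δ : ConjAct P,
      G.cuspGp c = δ • ((cuspInertia (g := g) (e c)).map ι).topologicalClosure)
    (hgen : ∀ v, G.genus v = g) (V : Subgroup P) [V.Normal] (hVo : IsOpen (V : Set P)) {n : ℕ}
    (hn : r + 1 ≤ n) (hN : ∀ j, V.comap ι ⊓ cuspInertia (g := g) j = Subgroup.zpowers (c (g := g) j ^ n))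
    (U : Subgroup P) [U.FiniteIndex] (hU : IsOpen (U : Set P)) (hUV : U ≤ V)
    (w : (G.restrict U hU).graph.V) : 2 ≤ (G.restrict U hU).genus w := by
  classical
  obtain ⟨-, -, -, g', r', ι', e', h', -, hRH, hgen', -⟩ :=
    G.restrict_smoothCurveGenuine U hU hV v₀ hv h ι hι e hC hgen
  rw [hgen' w]
  -- `r' = Σ_c #(U \ Π / Π_c)`
  have hr' : r' = ∑ c : G.graph.C, Nat.card (DoubleCoset.Quotient (U : Set P) (G.cuspGp c : Set P)) := by
    have h1 := Fintype.card_congr e'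
    rw [Fintype.card_fin] at h1
    rw [← h1]
    change Fintype.card (Σ c : G.graph.C, dcFin U (G.cuspGp c)) = _
    rw [Fintype.card_sigma]
    exact Finset.sum_congr rfl fun c _ => Fintype.card_fin _
  -- `n · #(U \ Π / Π_c) ≤ [Π : U]` for every cusp
  have hcusp : ∀ c : G.graph.C,
      Nat.card (DoubleCoset.Quotient (U : Set P) (G.cuspGp c : Set P)) * n ≤ U.index := by
    intro c
    obtain ⟨δ, hδ⟩ := hC c
    have hmem : δ • ι (PuncturedSurfaceGroup.c (g := g) (e c)) ∈ G.cuspGp c := by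
      rw [hδ]
      exact Subgroup.smul_mem_pointwise_smul _ _ _
        (Subgroup.le_topologicalClosure _ (Subgroup.mem_map_of_mem ι (Subgroup.mem_zpowers _)))
    have hrel : n ≤ V.relIndex (G.cuspGp c) :=
      le_relIndex_of_comap_inf_cuspInertia_eq h ι V hVo (e c) (hN (e c)) (G.cuspGp c) δ hmem
    exact (Nat.mul_le_mul_left _ hrel).trans
      (natCard_doubleCosetQuotient_mul_relIndex_le_index U V (G.cuspGp c) hUV)
  have hsum : r' * n ≤ r * U.index := by
    rw [hr', Finset.sum_mul]
    refine (Finset.sum_le_sum fun c _ => hcusp c).trans ?_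
    rw [Finset.sum_const, Finset.card_univ, smul_eq_mul, Fintype.card_congr e, Fintype.card_fin]
  -- arithmetic: `2g' + r' + 2d = d(2g + r) + 2`, `n r' ≤ r d`, `n ≥ r + 1`, `2g + r ≥ 3`, `d ≥ 1`
  have hd : 1 ≤ U.index := Nat.pos_of_ne_zero Subgroup.FiniteIndex.index_ne_zero
  have hχ : 3 ≤ 2 * g + r := by unfold IsHyperbolicType at h; omega
  by_contra hlt
  have hg' : g' ≤ 1 := by omega
  have h3d : U.index * 3 ≤ U.index * (2 * g + r) := Nat.mul_le_mul_left _ hχ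
  have hrd : U.index ≤ r' := by omega
  have h1 : U.index * n ≤ r' * n := Nat.mul_le_mul_right _ hrd
  have h2 : U.index * (r + 1) ≤ U.index * n := Nat.mul_le_mul_left _ hn
  rw [Nat.mul_add, Nat.mul_one] at h2
  have h4 : r * U.index = U.index * r := Nat.mul_comm _ _
  omega

/-- **Existence of the level**: for a genuine smooth-curve datum of type `(g, r)` there is an open NORMAL
`V ⊴ Π` below which every covering `G_U` (`U ≤ V` open) has all its vertices of genus `≥ 2`: `V` is the
open subgroup with `ι⁻¹(V) = N`, `N ⊴ Γ_{g,r}` of `Σ`-integer index with `N ∩ ⟨c_j⟩ = ⟨c_j^{ℓ^r}⟩` for all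
`j` (`ℓ ∈ Σ`; `PuncturedSurfaceGroup.exists_normal_inf_cuspInertia_eq`, abc-iut-L3-t4).
[cite: MochizukiCombGC2007, Rmk 1.1.5 p.8] -/
theorem exists_open_normal_forall_two_le_genus_restrict (hV : ∀ v, G.vertGp v = ⊤) (v₀ : G.graph.V)
    (hv : ∀ w, w = v₀) (h : IsHyperbolicType g r) (ι : PuncturedSurfaceGroup g r →* P)
    (hι : IsProSigmaCompletion G.Sigma ι) (e : G.graph.C ≃ Fin r)
    (hC : ∀ c, ∃ δ : ConjAct P,
      G.cuspGp c = δ • ((cuspInertia (g := g) (e c)).map ι).topologicalClosure)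
    (hgen : ∀ v, G.genus v = g) :
    ∃ V : Subgroup P, IsOpen (V : Set P) ∧ V.Normal ∧
      ∀ (U : Subgroup P) [U.FiniteIndex] (hU : IsOpen (U : Set P)), U ≤ V →
        ∀ w : (G.restrict U hU).graph.V, 2 ≤ (G.restrict U hU).genus w := by
  obtain ⟨ℓ, hℓS⟩ := G.sigma_nonempty
  have hℓ : ℓ.Prime := G.sigma_prime ℓ hℓS
  set n : ℕ := ℓ ^ r with hn
  have hn0 : 0 < n := pow_pos hℓ.pos r
  have hn1 : r + 1 ≤ n := by
    have h2 : r < 2 ^ r := Nat.lt_two_pow_self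
    have h3 : 2 ^ r ≤ ℓ ^ r := Nat.pow_le_pow_left hℓ.two_le r
    omega
  obtain ⟨N, hNn, hNidx, hNcusp⟩ := exists_normal_inf_cuspInertia_eq (g := g) h hn0
  have hNS : IsSigmaInteger G.Sigma N.index := by
    refine (isSigmaInteger_prime_pow hℓ hℓS (r * 3)).of_dvd ?_
    rw [pow_mul]
    exact hNidx
  haveI := hNn
  obtain ⟨V, hVo, hVc⟩ := hι.comap_surj N hNn hNS
  haveI hVn : V.Normal := normal_of_comap_normal hι V hVo (by rw [hVc]; exact hNn)
  refine ⟨V, hVo, hVn, fun U _ hU hUV w => ?_⟩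
  exact G.two_le_genus_restrict_of_le hV v₀ hv h ι hι e hC hgen V hVo hn1
    (fun j => by rw [hVc]; exact hNcusp j) U hU hUV w

end Genus

end PSCDatum

end Literature.AnabelianGeometry.SemiGraphs

end
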